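import Literature.MathematicalPhysics.QuantumLattice.LiebWuResolventSeries
import Literature.MeasureTheory.Lebesgue.SubconvolutionVanishing
import Mathlib.MeasureTheory.Measure.OpenPos
import HarnessLib

/-!
# The resolvent `(1 + K̂²B̂)⁻¹`: positivity, monotonicity in the source and in `B`, uniqueness

Family `hubbard`. Continuation of `LiebWuResolventSeries` (Lieb–Wu, Physica A 321 (2003) 1, §5, proof of
Lemma 2): for the solution `V = V_S ζ` of `V = ζ + Û(1 - B̂)V` ("the solution to the equation
`(1 + K̂²B̂)S = K̂g` has the property … that `S(x) ≥ 0` and that `S(x)` is a non-increasing function of `B`,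
provided only that `g(x) ≥ 0` … the integral kernel of `V̂ = (1 + K̂²B̂)⁻¹` is positive and is a pointwise
monotone decreasing function of `B`"):

* `liebWuResolvent_add`, `liebWuResolvent_mono`: `V_S` is additive and monotone in the source `ζ ≥ 0`
  (positive kernel);
* `liebWuResolvent_antitone_set`: `S ⊆ S'` ⇒ `V_{S'} ζ ≤ V_S ζ` (kernel decreasing in `B̂`; Lemma 1 with `A = 0`);
* `eq_liebWuResolvent_of_fixedPoint`: **uniqueness** — a continuous integrable `X` with `X = ζ + Û(1 - B̂)X`
  IS `V_S ζ` (Theorem 1 with `A = 0`: `|X - V| ≤ u ∗ |X - V|`, `∫u = ½ < 1`, sub-convolution vanishing).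

No named fact.

## References

* E. H. Lieb, F. Y. Wu, Physica A 321 (2003) 1–27 = arXiv:cond-mat/0207529, §5, proof of Lemma 2 (eq.
  (general)), Theorem 1, Lemma 1 (key `LiebWuPhysicaA2003`).
-/

noncomputable section

open MeasureTheory Set Real Filter intervalIntegral
open Literature.Analysis.SpecialFunctions Literature.MeasureTheory.Lebesgue
open scoped Convolution Topology

namespace Literature.MathematicalPhysics.QuantumLattice

variable {U : ℝ} {S S' : Set ℝ} {ζ ζ₁ ζ₂ : ℝ → ℝ} {M M₁ M₂ : ℝ}

/-! ### Additivity and monotonicity in the source -/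

/-- The terms are additive in the source. [cite: LiebWuPhysicaA2003, §5, proof of Lemma 2] -/
theorem liebWuResolventTerm_add (hU : 0 < U) (hS : MeasurableSet S) (h₁c : Continuous ζ₁) (h₁0 : ∀ x, 0 ≤ ζ₁ x)
    (h₁i : Integrable ζ₁) (h₂c : Continuous ζ₂) (h₂0 : ∀ x, 0 ≤ ζ₂ x) (h₂i : Integrable ζ₂) (n : ℕ) (x : ℝ) :
    liebWuResolventTerm U S (fun t => ζ₁ t + ζ₂ t) n x =
      liebWuResolventTerm U S ζ₁ n x + liebWuResolventTerm U S ζ₂ n x := by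
  induction n generalizing x with
  | zero => rfl
  | succ n ih =>
    have h1 := (liebWuResolventTerm_props hU hS h₁c h₁0 h₁i n).2.2.1
    have h2 := (liebWuResolventTerm_props hU hS h₂c h₂0 h₂i n).2.2.1
    show liebWuT U S (liebWuResolventTerm U S (fun t => ζ₁ t + ζ₂ t) n) x = _
    rw [show liebWuResolventTerm U S (fun t => ζ₁ t + ζ₂ t) n =
      fun t => liebWuResolventTerm U S ζ₁ n t + liebWuResolventTerm U S ζ₂ n t from funext ih]
    exact liebWuT_add hU hS h1 h2 x

/-- **`V_S` is additive in the source** (`V̂` is linear). [cite: LiebWuPhysicaA2003, §5, proof of Lemma 2] -/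
theorem liebWuResolvent_add (hU : 0 < U) (hS : MeasurableSet S) (h₁c : Continuous ζ₁) (h₁0 : ∀ x, 0 ≤ ζ₁ x)
    (h₁i : Integrable ζ₁) (h₁M : ∀ x, ζ₁ x ≤ M₁) (h₂c : Continuous ζ₂) (h₂0 : ∀ x, 0 ≤ ζ₂ x) (h₂i : Integrable ζ₂)
    (h₂M : ∀ x, ζ₂ x ≤ M₂) (x : ℝ) :
    liebWuResolvent U S (fun t => ζ₁ t + ζ₂ t) x = liebWuResolvent U S ζ₁ x + liebWuResolvent U S ζ₂ x := by
  rw [liebWuResolvent, liebWuResolvent, liebWuResolvent,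
    ← (summable_liebWuResolventTerm hU hS h₁c h₁0 h₁i h₁M x).tsum_add
      (summable_liebWuResolventTerm hU hS h₂c h₂0 h₂i h₂M x)]
  exact tsum_congr fun n => liebWuResolventTerm_add hU hS h₁c h₁0 h₁i h₂c h₂0 h₂i n x

/-- The terms are monotone in the source. [cite: LiebWuPhysicaA2003, §5, proof of Lemma 2] -/
theorem liebWuResolventTerm_mono (hU : 0 < U) (hS : MeasurableSet S) (h₁c : Continuous ζ₁) (h₁0 : ∀ x, 0 ≤ ζ₁ x)
    (h₁i : Integrable ζ₁) (h₂c : Continuous ζ₂) (h₂0 : ∀ x, 0 ≤ ζ₂ x) (h₂i : Integrable ζ₂) (hle : ∀ x, ζ₁ x ≤ ζ₂ x)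
    (n : ℕ) (x : ℝ) : liebWuResolventTerm U S ζ₁ n x ≤ liebWuResolventTerm U S ζ₂ n x := by
  induction n generalizing x with
  | zero => exact hle x
  | succ n ih =>
    exact liebWuT_mono hU hS (liebWuResolventTerm_props hU hS h₁c h₁0 h₁i n).2.2.1
      (liebWuResolventTerm_props hU hS h₂c h₂0 h₂i n).2.2.1 ih x

/-- **`V_S` is monotone in the source** ("the integral kernel of `V̂` is positive").
[cite: LiebWuPhysicaA2003, §5, proof of Lemma 2] -/
theorem liebWuResolvent_mono (hU : 0 < U) (hS : MeasurableSet S) (h₁c : Continuous ζ₁) (h₁0 : ∀ x, 0 ≤ ζ₁ x)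
    (h₁i : Integrable ζ₁) (h₁M : ∀ x, ζ₁ x ≤ M₁) (h₂c : Continuous ζ₂) (h₂0 : ∀ x, 0 ≤ ζ₂ x) (h₂i : Integrable ζ₂)
    (h₂M : ∀ x, ζ₂ x ≤ M₂) (hle : ∀ x, ζ₁ x ≤ ζ₂ x) (x : ℝ) :
    liebWuResolvent U S ζ₁ x ≤ liebWuResolvent U S ζ₂ x :=
  Summable.tsum_le_tsum (fun n => liebWuResolventTerm_mono hU hS h₁c h₁0 h₁i h₂c h₂0 h₂i hle n x)
    (summable_liebWuResolventTerm hU hS h₁c h₁0 h₁i h₁M x) (summable_liebWuResolventTerm hU hS h₂c h₂0 h₂i h₂M x)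

/-! ### Monotonicity in the range (`A = 0` case of Lemma 1) -/

/-- The terms decrease as the range grows. [cite: LiebWuPhysicaA2003, §5, proof of Lemma 2] -/
theorem liebWuResolventTerm_antitone_set (hU : 0 < U) (hS : MeasurableSet S) (hS' : MeasurableSet S')
    (hSS' : S ⊆ S') (hζc : Continuous ζ) (hζ0 : ∀ x, 0 ≤ ζ x) (hζi : Integrable ζ) (n : ℕ) (x : ℝ) :
    liebWuResolventTerm U S' ζ n x ≤ liebWuResolventTerm U S ζ n x := by
  induction n generalizing x with
  | zero => exact le_rfl
  | succ n ih =>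
    obtain ⟨_, h0', hi', _⟩ := liebWuResolventTerm_props hU hS' hζc hζ0 hζi n
    obtain ⟨_, h0, hi, _⟩ := liebWuResolventTerm_props hU hS hζc hζ0 hζi n
    calc liebWuResolventTerm U S' ζ (n + 1) x = liebWuT U S' (liebWuResolventTerm U S' ζ n) x := rfl
      _ ≤ liebWuT U S' (liebWuResolventTerm U S ζ n) x := liebWuT_mono hU hS' hi' hi ih x
      _ ≤ liebWuT U S (liebWuResolventTerm U S ζ n) x := liebWuT_antitone_set hU hS hS' hSS' hi h0 x
      _ = liebWuResolventTerm U S ζ (n + 1) x := rfl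

/-- **`S ⊆ S'` ⇒ `V_{S'} ζ ≤ V_S ζ`** ("`S(x)` is a non-increasing function of `B` … the integral kernel of `V̂` is
a pointwise monotone decreasing function of `B`"). [cite: LiebWuPhysicaA2003, §5, proof of Lemma 2] -/
theorem liebWuResolvent_antitone_set (hU : 0 < U) (hS : MeasurableSet S) (hS' : MeasurableSet S') (hSS' : S ⊆ S')
    (hζc : Continuous ζ) (hζ0 : ∀ x, 0 ≤ ζ x) (hζi : Integrable ζ) (hζM : ∀ x, ζ x ≤ M) (x : ℝ) :
    liebWuResolvent U S' ζ x ≤ liebWuResolvent U S ζ x :=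
  Summable.tsum_le_tsum (fun n => liebWuResolventTerm_antitone_set hU hS hS' hSS' hζc hζ0 hζi n x)
    (summable_liebWuResolventTerm hU hS' hζc hζ0 hζi hζM x) (summable_liebWuResolventTerm hU hS hζc hζ0 hζi hζM x)

/-! ### Uniqueness of the fixed point (`A = 0` case of Theorem 1) -/

/-- **Uniqueness:** a continuous integrable solution `X` of `X = ζ + Û(1 - B̂)X` coincides with `V_S ζ`
everywhere (`|X - V| ≤ u ∗ |X - V|` with `∫u = ½ < 1`). [cite: LiebWuPhysicaA2003, §5, Theorem 1 (A = 0)] -/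
theorem eq_liebWuResolvent_of_fixedPoint (hU : 0 < U) (hS : MeasurableSet S) (hζc : Continuous ζ)
    (hζ0 : ∀ x, 0 ≤ ζ x) (hζi : Integrable ζ) (hζM : ∀ x, ζ x ≤ M) {X : ℝ → ℝ} (hXc : Continuous X)
    (hXi : Integrable X) (hX : ∀ x, X x = ζ x + liebWuT U S X x) : X = liebWuResolvent U S ζ := by
  have hc : 0 < U / 4 := by positivity
  have huc : Continuous (fermiKernel (U / 4)) := continuous_fermiKernel hc
  have hui : Integrable (fermiKernel (U / 4)) := integrable_fermiKernel hc
  have huB : ∀ y, |fermiKernel (U / 4) y| ≤ 1 / (2 * π * (U / 4)) := fun y => by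
    rw [abs_of_nonneg (fermiKernel_nonneg hc y)]; exact fermiKernel_le hc y
  set V := liebWuResolvent U S ζ with hV
  have hVc : Continuous V := continuous_liebWuResolvent hU hS hζc hζ0 hζi hζM
  have hVi : Integrable V := integrable_liebWuResolvent hU hS hζc hζ0 hζi hζM
  have hVeq : ∀ x, V x = ζ x + liebWuT U S V x := liebWuResolvent_eq hU hS hζc hζ0 hζi hζM
  -- `D = X - V` satisfies `D = Û(1 - B̂)D`
  set D : ℝ → ℝ := fun x => X x - V x with hD
  have hDi : Integrable D := hXi.sub hVi
  have hDc : Continuous D := hXc.sub hVc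
  have hDeq : ∀ x, D x = liebWuT U S D x := by
    intro x
    have hsplit : liebWuT U S X x = liebWuT U S D x + liebWuT U S V x := by
      rw [← liebWuT_add hU hS hDi hVi]
      congr 1
      funext t
      simp only [hD, sub_add_cancel]
    simp only [hD]
    rw [hX x, hVeq x, hsplit]
    ring
  -- `|D| ≤ u ∗ |D|`
  set g : ℝ → ℝ := fun x => |D x| with hg
  have hgi : Integrable g := hDi.abs
  have hgm : Measurable g := hDc.measurable.abs
  have hdom : ∀ x, g x ≤ ∫ y, fermiKernel (U / 4) (x - y) * g y := by
    intro x
    have h1 : |liebWuT U S D x| ≤ ∫ t, |Sᶜ.indicator D t * fermiKernel (U / 4) (x - t)| :=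
      abs_integral_le_integral_abs
    have h2 : ∫ t, |Sᶜ.indicator D t * fermiKernel (U / 4) (x - t)| ≤ ∫ y, fermiKernel (U / 4) (x - y) * g y := by
      refine integral_mono_of_nonneg (Eventually.of_forall fun t => abs_nonneg _) ?_ (Eventually.of_forall fun t => ?_)
      · exact hgi.bdd_mul (f := fun t => fermiKernel (U / 4) (x - t)) (c := 1 / (2 * π * (U / 4)))
          ((huc.comp (continuous_const.sub continuous_id)).aestronglyMeasurable)
          (Eventually.of_forall fun t => by rw [Real.norm_eq_abs]; exact huB _)
      · dsimp only
        rw [abs_mul, abs_of_nonneg (fermiKernel_nonneg hc _), mul_comm]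
        refine mul_le_mul_of_nonneg_left ?_ (fermiKernel_nonneg hc _)
        by_cases ht : t ∈ Sᶜ
        · rw [indicator_of_mem ht]
        · rw [indicator_of_notMem ht, abs_zero]; exact abs_nonneg _
    calc g x = |liebWuT U S D x| := by rw [hg]; exact congrArg _ (hDeq x)
      _ ≤ _ := h1.trans h2
  have hg0 : g =ᵐ[volume] 0 :=
    ae_eq_zero_of_le_integral_sub huc.measurable hgm (fermiKernel_nonneg hc) (fun x => abs_nonneg _) hui hgi
      (by rw [integral_fermiKernel hc]; norm_num) (Eventually.of_forall hdom)
  have hD0 : D =ᵐ[volume] (fun _ => (0 : ℝ)) := by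
    filter_upwards [hg0] with x hx
    simpa [hg] using hx
  have hD0' : D = fun _ => 0 := (Continuous.ae_eq_iff_eq volume hDc continuous_const).1 hD0
  funext x
  have := congrFun hD0' x
  simp only [hD] at this
  linarith

end Literature.MathematicalPhysics.QuantumLattice

end
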